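import Summits.BirchSwinnertonDyer.BirchSwinnertonDyer.Theorems.GoldfeldAllTwistsTwoConverseTwinQuarterTraceHalving
import HarnessLib

set_option linter.dupNamespace false -- namespace `…BirchSwinnertonDyer.BirchSwinnertonDyer…` is the cell's (D-0017 nested layout)
set_option autoImplicit false

/-!
# LINE B⁗, file X1: the GENUS-COSET DIFFERENCE of the quarter trace — `σ̃_pΨ` is the neighbouring quarter sum, `2•(σ̃_pΨ − Ψ) = −(P_e + P_p)`,
# and an odd multiple of `σ̃_pΨ − Ψ` is never `2•R + T` (descent class `[7]` excluded by X2); hence X4's key hypothesis `hKey`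

Cell `bsd-goldfeld`, seat `bsd-goldfeld-s1p-c3x` (gen 10); planner ORDER (ccxcix) TRANCHE 2, object X1 (memo `HOME/B4-SIGNATURES.md` §2 (b),(L),
§4 X1). `--supports stmt-BirchSwinnertonDyer-19140` as a HELPER (twin″, formula axis of `49a1^{(−2qp)}`). Theses-free; theorems only; no definition,
no `sorry`, no new fact; NO print binder (the key lemma of X2 enters as a hypothesis `hX2` in its exact landed shape).

SETTING. `L/K` finite Galois (here `L = K[1]`), `r_q, r_p ∈ L` square roots of elements of `K`, `y ∈ X₀(49)(L)`; the quarter sum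
`Ψ = Σ_{σ : σr_q = r_q ∧ σr_p = r_p} σy` and its `p`-neighbour `Ψ₊₋ = Σ_{σ : σr_q = r_q ∧ σr_p = −r_p} σy`; the genus sums
`P_e = Σ χ_qχ_p•σy`, `P_p = Σ χ_p•σy` in the shape of `quarterTrace_sum_identity`.
* §1 `map_sum_smul_map_eq_sum_inv_mul` (re-indexing `σ ↦ σ̃σ`), `mul_apply_sqrt_eq_iff_of_apply_eq_neg`; §2 two sign identities (abstract);
* §3 `map_quarterSum_eq_cosetSum`: for `σ̃ ∈ Gal(L/K)` with `σ̃r_q = r_q`, `σ̃r_p = −r_p`: `σ̃Ψ = Ψ₊₋`; `two_zsmul_cosetSum_sub_quarterSum`: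
  `2•(Ψ₊₋ − Ψ) = −(P_e + P_p)`;
* §4 `isSquare_seven_mul_prod_of_odd_zsmul_cosetDifference`: `y = (x₁, y₁)`, `x₁ ≠ 2`, `n` odd, `n•(Ψ₊₋ − Ψ) = 2•R + T` ⟹ `7·∏_{σr_q = r_q}(σx₁ − 2) ∈ L^{×2}`
  (K8's descent lemma on the SIGNED sum `Σ_{σ r_q = r_q} ±σy`, all terms with abscissa `σx₁`);
* §5 `exists_odd_zsmul_cosetEta_eq_zero`: with the `e`- and `p`-package relations `M_e•P_e = 4•R_e + t_e`, `M_p•P_p = 4•R_p + t_p` (odd multiples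
  of `t_e, t_p` in `{O,T}`), `X₀(49)(L)[4] ⊆ {O,T}` and X2's conclusion `hX2`: an ODD `k` kills `η = N•(Ψ₊₋ − Ψ) + 2N_e•R_e + 2N_p•R_p`
  (`N = N_eM_e = N_pM_p` odd) — exactly the hypothesis `hKey` of X4 `exists_odd_zsmul_map_sub_eq_twoTorsion` after `σ̃Ψ = Ψ₊₋`.
HONEST FRAMING: Galois bookkeeping and `2`-descent algebra on `X₀(49)(K[1])`; no Heegner point is shown non-torsion or non-divisible here; items
19140 / 19350 / 20044 unchanged; BSD is not proved by any of this.

References: [Gross1984] §§4–5; [GrossLMS1991] Prop. 5.3; [CoatesLiTianZhai2015] Thm. 2.5 and (2.8); [SilvermanTate2015] §3.5.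
-/

noncomputable section

open scoped Classical

open WeierstrassCurve Literature.NumberTheory.EllipticCurves Literature.NumberTheory.EllipticCurves.ModularForms

namespace Summit.BirchSwinnertonDyer.BirchSwinnertonDyer.Theorems.GoldfeldGoodTwists

/-! ## §1 Re-indexing a weighted Galois sum under `σ̃`; the sign of a square root under `σ̃σ` -/
section Reindex

variable {k : Type*} {L : Type*} [Field k] [CharZero k] [Field L] [CharZero L] [Algebra k L]

/-- **`σ̃(Σ_σ ε(σ)•σy) = Σ_σ ε(σ̃⁻¹σ)•σy`** (re-index by `σ ↦ σ̃σ`). [folklore] -/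
theorem map_sum_smul_map_eq_sum_inv_mul [FiniteDimensional k L] (τ : L ≃ₐ[k] L) (ε : (L ≃ₐ[k] L) → ℤ)
    (y : (cm7.baseChange L).toAffine.Point) :
    Affine.Point.map (τ : L →ₐ[k] L) (∑ σ : L ≃ₐ[k] L, ε σ • Affine.Point.map (σ : L →ₐ[k] L) y) =
      ∑ σ : L ≃ₐ[k] L, ε (τ⁻¹ * σ) • Affine.Point.map (σ : L →ₐ[k] L) y := by
  rw [map_sum]
  simp_rw [map_zsmul, Affine.Point.map_map]
  have h : ∀ σ : L ≃ₐ[k] L, ((τ : L →ₐ[k] L).comp (σ : L →ₐ[k] L)) = ((τ * σ : L ≃ₐ[k] L) : L →ₐ[k] L) := fun σ ↦ rfl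
  simp_rw [h]
  calc ∑ σ : L ≃ₐ[k] L, ε σ • Affine.Point.map ((τ * σ : L ≃ₐ[k] L) : L →ₐ[k] L) y
      = ∑ σ : L ≃ₐ[k] L, ε (τ⁻¹ * (τ * σ)) • Affine.Point.map ((τ * σ : L ≃ₐ[k] L) : L →ₐ[k] L) y := by
        simp_rw [inv_mul_cancel_left]
    _ = ∑ σ : L ≃ₐ[k] L, ε (τ⁻¹ * σ) • Affine.Point.map (σ : L →ₐ[k] L) y :=
        Fintype.sum_equiv (Equiv.mulLeft τ) _ _ fun _ ↦ rfl

omit [CharZero k] in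
/-- If `τ r₀ = −r₀` (`r₀ ≠ 0` a square root of `d ∈ k`, characteristic `≠ 2`) then `(τσ) r₀ = r₀ ↔ σ r₀ = −r₀`. [folklore] -/
theorem mul_apply_sqrt_eq_iff_of_apply_eq_neg (τ σ : L ≃ₐ[k] L) {r₀ : L} {d : k} (hr : r₀ ^ 2 = algebraMap k L d)
    (hr0 : r₀ ≠ 0) (hτ : τ r₀ = -r₀) : (τ * σ) r₀ = r₀ ↔ σ r₀ = -r₀ := by
  have hne : -r₀ ≠ r₀ := fun h ↦ hr0 (CharZero.neg_eq_self_iff.mp h)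
  rw [AlgEquiv.mul_apply]
  rcases apply_sqrt_eq_self_or_neg σ hr with h | h
  · rw [h, hτ]
    exact ⟨fun h' ↦ absurd h' hne, fun h' ↦ absurd h' hne.symm⟩
  · rw [h, map_neg, hτ, neg_neg]
    exact ⟨fun _ ↦ rfl, fun _ ↦ rfl⟩

end Reindex

/-! ## §2 Two sign identities (abstract) -/
section Identity

variable {ι A : Type*} [Fintype ι] [AddCommGroup A]

/-- **`2•(Ψ₊₋ − Ψ₊₊) = −(P_e + P_p)`** termwise: `2([s_q ∧ ¬s_p] − [s_q ∧ s_p]) = −(χ_qχ_p + χ_p)`. [folklore] -/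
theorem two_zsmul_cosetDifference (sq sp sp' : ι → Prop) [DecidablePred sq] [DecidablePred sp] [DecidablePred sp']
    (h : ∀ i, sp' i ↔ ¬ sp i) (f : ι → A) :
    (2 : ℤ) • (∑ i, (if sq i ∧ sp' i then (1 : ℤ) else 0) • f i - ∑ i, (if sq i ∧ sp i then (1 : ℤ) else 0) • f i) =
      -(∑ i, ((if sq i then (1 : ℤ) else -1) * (if sp i then (1 : ℤ) else -1)) • f i +
        ∑ i, (if sp i then (1 : ℤ) else -1) • f i) := by
  rw [← Finset.sum_sub_distrib, ← Finset.sum_add_distrib, Finset.smul_sum, ← Finset.sum_neg_distrib]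
  refine Finset.sum_congr rfl fun i _ ↦ ?_
  have hi := h i
  by_cases h1 : sq i <;> by_cases h2 : sp i <;> simp [h1, h2, hi] <;> abel

/-- The coset difference as a SIGNED sum over the `q`-stabiliser: `Ψ₊₋ − Ψ₊₊ = Σ_{s_q i} (−1)^{[s_p i]} f i`. [folklore] -/
theorem cosetDifference_eq_sum_filter (sq sp sp' : ι → Prop) [DecidablePred sq] [DecidablePred sp] [DecidablePred sp']
    (h : ∀ i, sp' i ↔ ¬ sp i) (f : ι → A) :
    ∑ i, (if sq i ∧ sp' i then (1 : ℤ) else 0) • f i - ∑ i, (if sq i ∧ sp i then (1 : ℤ) else 0) • f i =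
      ∑ i ∈ Finset.univ.filter sq, (if sp i then -f i else f i) := by
  rw [← Finset.sum_sub_distrib, Finset.sum_filter]
  refine Finset.sum_congr rfl fun i _ ↦ ?_
  have hi := h i
  by_cases h1 : sq i <;> by_cases h2 : sp i <;> simp [h1, h2, hi]

end Identity

/-! ## §3 The `p`-neighbour of the quarter sum -/
section Coset

variable {K : Type} [Field K] [NumberField K] {L : Type} [Field L] [CharZero L] [Algebra K L] [FiniteDimensional K L]

-- the cell's point-group world over `K[1]`; section-local
attribute [local instance 2000] Classical.propDecidable

/-- **`σ̃Ψ = Ψ₊₋`**: a `σ̃ ∈ Gal(L/K)` fixing `r_q` and negating `r_p` (`r_p ≠ 0`) carries the quarter sum `Ψ = Σ_{σr_q = r_q ∧ σr_p = r_p} σy` to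
its `p`-neighbour `Ψ₊₋ = Σ_{σr_q = r_q ∧ σr_p = −r_p} σy`. [cite: Gross1984, §4] -/
theorem map_quarterSum_eq_cosetSum (τ : L ≃ₐ[K] L) {rq rp : L} {a b : K} (hrq : rq ^ 2 = algebraMap K L a)
    (hrp : rp ^ 2 = algebraMap K L b) (hrp0 : rp ≠ 0) (h1 : τ rq = rq) (h2 : τ rp = -rp) (y : (cm7.baseChange L).toAffine.Point) :
    Affine.Point.map (τ : L →ₐ[K] L) (∑ σ : L ≃ₐ[K] L,
        (@ite ℤ (σ rq = rq ∧ σ rp = rp) instDecidableAnd (1 : ℤ) 0) • Affine.Point.map (σ : L →ₐ[K] L) y) =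
      ∑ σ : L ≃ₐ[K] L,
        (@ite ℤ (σ rq = rq ∧ σ rp = -rp) instDecidableAnd (1 : ℤ) 0) • Affine.Point.map (σ : L →ₐ[K] L) y := by
  rw [map_sum_smul_map_eq_sum_inv_mul]
  refine Finset.sum_congr rfl fun σ _ ↦ ?_
  have h1' : τ⁻¹ rq = rq := by
    have e : τ⁻¹ (τ rq) = rq := by rw [← AlgEquiv.mul_apply, inv_mul_cancel, AlgEquiv.one_apply]
    rwa [h1] at e
  have h2' : τ⁻¹ rp = -rp := by
    have e : τ⁻¹ (τ rp) = rp := by rw [← AlgEquiv.mul_apply, inv_mul_cancel, AlgEquiv.one_apply]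
    rw [h2, map_neg] at e
    exact neg_eq_iff_eq_neg.mp e
  have e1 := mul_apply_sqrt_eq_iff_of_apply_eq τ⁻¹ σ hrq h1'
  have e2 := mul_apply_sqrt_eq_iff_of_apply_eq_neg τ⁻¹ σ hrp hrp0 h2'
  by_cases hc : σ rq = rq ∧ σ rp = -rp
  · rw [if_pos hc, if_pos (show (τ⁻¹ * σ) rq = rq ∧ (τ⁻¹ * σ) rp = rp from ⟨e1.mpr hc.1, e2.mpr hc.2⟩)]
  · rw [if_neg hc, if_neg (show ¬ ((τ⁻¹ * σ) rq = rq ∧ (τ⁻¹ * σ) rp = rp) from fun h ↦ hc ⟨e1.mp h.1, e2.mp h.2⟩)]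

/-- **`2•(Ψ₊₋ − Ψ) = −(P_e + P_p)`** in the shape of `quarterTrace_sum_identity` (`r_p ≠ 0`, so `σr_p = −r_p ↔ σr_p ≠ r_p`).
[cite: Gross1984, §4] [cite: CoatesLiTianZhai2015, (2.8)] -/
theorem two_zsmul_cosetSum_sub_quarterSum {rq rp : L} {b : K} (hrp : rp ^ 2 = algebraMap K L b) (hrp0 : rp ≠ 0)
    (y : (cm7.baseChange L).toAffine.Point) :
    (2 : ℤ) • (∑ σ : L ≃ₐ[K] L, (@ite ℤ (σ rq = rq ∧ σ rp = -rp) instDecidableAnd (1 : ℤ) 0) • Affine.Point.map (σ : L →ₐ[K] L) y -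
        ∑ σ : L ≃ₐ[K] L, (@ite ℤ (σ rq = rq ∧ σ rp = rp) instDecidableAnd (1 : ℤ) 0) • Affine.Point.map (σ : L →ₐ[K] L) y) =
      -(∑ σ : L ≃ₐ[K] L, ((if σ rq = rq then (1 : ℤ) else -1) * (if σ rp = rp then (1 : ℤ) else -1)) •
            Affine.Point.map (σ : L →ₐ[K] L) y +
        ∑ σ : L ≃ₐ[K] L, (if σ rp = rp then (1 : ℤ) else -1) • Affine.Point.map (σ : L →ₐ[K] L) y) :=
  two_zsmul_cosetDifference (fun σ : L ≃ₐ[K] L ↦ σ rq = rq) (fun σ ↦ σ rp = rp) (fun σ ↦ σ rp = -rp)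
    (fun σ ↦ by
      have hne : -rp ≠ rp := fun h ↦ hrp0 (CharZero.neg_eq_self_iff.mp h)
      rcases apply_sqrt_eq_self_or_neg σ hrp with h | h
      · rw [h]; exact ⟨fun h' ↦ absurd h' hne.symm, fun h' ↦ absurd rfl h'⟩
      · rw [h]; exact ⟨fun _ ↦ hne, fun _ ↦ rfl⟩)
    (fun σ ↦ Affine.Point.map (σ : L →ₐ[K] L) y)

end Coset

/-! ## §4 The descent class of the coset difference: an odd multiple `= 2•R + T` forces `7·∏_{σr_q = r_q}(σx₁ − 2) ∈ L^{×2}` -/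
section DescentLink

variable {K : Type} [Field K] [NumberField K] {L : Type} [Field L] [CharZero L] [Algebra K L] [FiniteDimensional K L]

-- the cell's point-group world over `K[1]`; section-local
attribute [local instance 2000] Classical.propDecidable

/-- **Descent class of the coset difference.** `y = (x₁, y₁) ∈ X₀(49)(L)` affine with `x₁ ≠ 2`, `r_p ≠ 0` a square root off `K`; if an ODD
multiple of `Ψ₊₋ − Ψ` equals `2•R + T` for some `R ∈ X₀(49)(L)`, then `7 · ∏_{σ : σr_q = r_q}(σx₁ − 2)` is a square in `L`: the difference is
the SIGNED sum `Σ_{σr_q = r_q} ±σy`, every term of abscissa `σx₁`, and K8's `isSquare_seven_mul_prod_of_odd_zsmul_sum_eq_two_zsmul_add_twoTorsion`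
applies (`α(−P) = α(P)`). [cite: SilvermanTate2015, §3.5] -/
theorem isSquare_seven_mul_prod_of_odd_zsmul_cosetDifference {rq rp : L} {b : K} (hrp : rp ^ 2 = algebraMap K L b) (hrp0 : rp ≠ 0)
    {x₁ y₁ : L} (hxy : (cm7.baseChange L).toAffine.Nonsingular x₁ y₁) (hx2 : x₁ ≠ 2) {n : ℤ} (hn : Odd n)
    (R : (cm7.baseChange L).toAffine.Point)
    (hrel : n • (∑ σ : L ≃ₐ[K] L, (@ite ℤ (σ rq = rq ∧ σ rp = -rp) instDecidableAnd (1 : ℤ) 0) •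
          Affine.Point.map (σ : L →ₐ[K] L) (Affine.Point.some x₁ y₁ hxy) -
        ∑ σ : L ≃ₐ[K] L, (@ite ℤ (σ rq = rq ∧ σ rp = rp) instDecidableAnd (1 : ℤ) 0) •
          Affine.Point.map (σ : L →ₐ[K] L) (Affine.Point.some x₁ y₁ hxy)) =
      (2 : ℤ) • R + Affine.Point.some 2 (-1) (nonsingular_cm7_baseChange_two_neg_one L)) :
    IsSquare (7 * ∏ σ ∈ Finset.univ.filter (fun σ : L ≃ₐ[K] L ↦ σ rq = rq), (σ x₁ - 2)) := by
  -- each term `±σy` is affine with abscissa `σ x₁`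
  have hmapσ : ∀ σ : L ≃ₐ[K] L, ∃ hσ, Affine.Point.map (σ : L →ₐ[K] L) (Affine.Point.some x₁ y₁ hxy) =
      Affine.Point.some (σ x₁) (σ y₁) hσ := fun σ ↦ ⟨_, Affine.Point.map_some _ _⟩
  choose hσ hmapσ' using hmapσ
  set Yσ : (L ≃ₐ[K] L) → L := fun σ ↦ if σ rp = rp then (cm7.baseChange L).toAffine.negY (σ x₁) (σ y₁) else σ y₁ with hYσ
  have hns : ∀ σ : L ≃ₐ[K] L, (cm7.baseChange L).toAffine.Nonsingular (σ x₁) (Yσ σ) := fun σ ↦ by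
    by_cases h : σ rp = rp
    · rw [hYσ]; simp only [h, if_true]; exact (Affine.nonsingular_neg _ _).mpr (hσ σ)
    · rw [hYσ]; simp only [h, if_false]; exact hσ σ
  have hterm : ∀ σ : L ≃ₐ[K] L,
      (if σ rp = rp then -Affine.Point.map (σ : L →ₐ[K] L) (Affine.Point.some x₁ y₁ hxy)
        else Affine.Point.map (σ : L →ₐ[K] L) (Affine.Point.some x₁ y₁ hxy)) = Affine.Point.some (σ x₁) (Yσ σ) (hns σ) := by
    intro σ
    by_cases h : σ rp = rp
    · simp only [h, if_true, hYσ]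
      rw [hmapσ' σ, Affine.Point.neg_some]
    · simp only [h, if_false, hYσ]
      rw [hmapσ' σ]
  have hne : ∀ σ : L ≃ₐ[K] L, (σ rp = -rp ↔ ¬ σ rp = rp) := fun σ ↦ by
    have hne' : -rp ≠ rp := fun h ↦ hrp0 (CharZero.neg_eq_self_iff.mp h)
    rcases apply_sqrt_eq_self_or_neg σ hrp with h | h
    · rw [h]; exact ⟨fun h' ↦ absurd h' hne'.symm, fun h' ↦ absurd rfl h'⟩
    · rw [h]; exact ⟨fun _ ↦ hne', fun _ ↦ rfl⟩
  rw [cosetDifference_eq_sum_filter (fun σ : L ≃ₐ[K] L ↦ σ rq = rq) (fun σ ↦ σ rp = rp) (fun σ ↦ σ rp = -rp) hne] at hrel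
  have hsum : n • ∑ σ ∈ Finset.univ.filter (fun σ : L ≃ₐ[K] L ↦ σ rq = rq), Affine.Point.some (σ x₁) (Yσ σ) (hns σ) =
      (2 : ℤ) • R + Affine.Point.some 2 (-1) (nonsingular_cm7_baseChange_two_neg_one L) := by
    rw [← hrel]
    exact congrArg _ (Finset.sum_congr rfl fun σ _ ↦ (hterm σ).symm)
  have hx : ∀ σ ∈ Finset.univ.filter (fun σ : L ≃ₐ[K] L ↦ σ rq = rq), σ x₁ ≠ 2 := by
    intro σ _ hσ2
    apply hx2
    have : σ x₁ = σ 2 := by rw [hσ2, map_ofNat]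
    exact σ.injective this
  exact isSquare_seven_mul_prod_of_odd_zsmul_sum_eq_two_zsmul_add_twoTorsion _ hns hx hn R hsum

end DescentLink

/-! ## §5 X4's key hypothesis: an odd multiple of `η = N•(Ψ₊₋ − Ψ) + 2N_e•R_e + 2N_p•R_p` vanishes -/
section Key

variable {K : Type} [Field K] [NumberField K] {L : Type} [Field L] [CharZero L] [Algebra K L] [FiniteDimensional K L]

-- the cell's point-group world over `K[1]`; section-local
attribute [local instance 2000] Classical.propDecidable

set_option maxHeartbeats 400000 in -- one long bookkeeping lemma
/-- **X4's `hKey` from X2.** Data over `L = K[1]`: `y = (x₁, y₁)`, `x₁ ≠ 2`; the genus sums `P_e, P_p` with the package relations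
`M_e•P_e = 4•R_e + t_e`, `M_p•P_p = 4•R_p + t_p` (`t_e, t_p` with odd multiples in `{O, T}`); odd `N = N_eM_e = N_pM_p`; `X₀(49)(L)[4] ⊆ {O, T}`;
and X2's conclusion `hX2` (no `7·∏_{σ ∈ S}(σx₁ − 2)` is a square). THEN some odd `k` has `k • (N•(Ψ₊₋ − Ψ) + 2N_e•R_e + 2N_p•R_p) = 0`:
by §3 `2•η = −(N_e•t_e + N_p•t_p)`, so an odd multiple `kη` has `4•(kη) = 0`, `kη ∈ {O,T}`, and `kη = T` would make `kN•(Ψ₊₋ − Ψ) = 2•(…) + T`,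
excluded by §4 + `hX2`. [cite: GrossLMS1991, Prop. 5.3] [cite: SilvermanTate2015, §3.5] -/
theorem exists_odd_zsmul_cosetEta_eq_zero {rq rp : L} {b : K} (hrp : rp ^ 2 = algebraMap K L b) (hrp0 : rp ≠ 0)
    {x₁ y₁ : L} (hxy : (cm7.baseChange L).toAffine.Nonsingular x₁ y₁) (hx2 : x₁ ≠ 2)
    (hX2 : ∀ S : Finset (L ≃ₐ[K] L), ¬ IsSquare ((7 : L) * ∏ σ ∈ S, (σ x₁ - 2)))
    (h4 : ∀ x : (cm7.baseChange L).toAffine.Point, (4 : ℤ) • x = 0 →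
      x = 0 ∨ x = Affine.Point.some 2 (-1) (nonsingular_cm7_baseChange_two_neg_one L))
    {Re Rp te tp : (cm7.baseChange L).toAffine.Point} {Me Mp N Ne Np : ℤ} (hN : Odd N) (hNe : N = Ne * Me) (hNp : N = Np * Mp)
    (hPe : Me • ∑ σ : L ≃ₐ[K] L, ((if σ rq = rq then (1 : ℤ) else -1) * (if σ rp = rp then (1 : ℤ) else -1)) •
        Affine.Point.map (σ : L →ₐ[K] L) (Affine.Point.some x₁ y₁ hxy) = (4 : ℤ) • Re + te)
    (hPp : Mp • ∑ σ : L ≃ₐ[K] L, (if σ rp = rp then (1 : ℤ) else -1) •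
        Affine.Point.map (σ : L →ₐ[K] L) (Affine.Point.some x₁ y₁ hxy) = (4 : ℤ) • Rp + tp)
    (hte : ∃ k : ℤ, Odd k ∧ (k • te = 0 ∨ k • te = Affine.Point.some 2 (-1) (nonsingular_cm7_baseChange_two_neg_one L)))
    (htp : ∃ k : ℤ, Odd k ∧ (k • tp = 0 ∨ k • tp = Affine.Point.some 2 (-1) (nonsingular_cm7_baseChange_two_neg_one L))) :
    ∃ k : ℤ, Odd k ∧ k • (N • (∑ σ : L ≃ₐ[K] L, (@ite ℤ (σ rq = rq ∧ σ rp = -rp) instDecidableAnd (1 : ℤ) 0) •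
            Affine.Point.map (σ : L →ₐ[K] L) (Affine.Point.some x₁ y₁ hxy) -
          ∑ σ : L ≃ₐ[K] L, (@ite ℤ (σ rq = rq ∧ σ rp = rp) instDecidableAnd (1 : ℤ) 0) •
            Affine.Point.map (σ : L →ₐ[K] L) (Affine.Point.some x₁ y₁ hxy)) +
        (2 * Ne) • Re + (2 * Np) • Rp) = 0 := by
  set T : (cm7.baseChange L).toAffine.Point := Affine.Point.some 2 (-1) (nonsingular_cm7_baseChange_two_neg_one L) with hT
  set D := ∑ σ : L ≃ₐ[K] L, (@ite ℤ (σ rq = rq ∧ σ rp = -rp) instDecidableAnd (1 : ℤ) 0) •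
        Affine.Point.map (σ : L →ₐ[K] L) (Affine.Point.some x₁ y₁ hxy) -
      ∑ σ : L ≃ₐ[K] L, (@ite ℤ (σ rq = rq ∧ σ rp = rp) instDecidableAnd (1 : ℤ) 0) •
        Affine.Point.map (σ : L →ₐ[K] L) (Affine.Point.some x₁ y₁ hxy) with hD
  have hT2 : 2 • T = 0 := by rw [two_nsmul]; exact cm7_twoTorsion_add_self L
  have hT2z : (2 : ℤ) • T = 0 := by exact_mod_cast hT2
  have hT0 : T ≠ 0 := Affine.Point.some_ne_zero _
  obtain ⟨ke, hke, hkeu⟩ := hte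
  obtain ⟨kp, hkp, hkpu⟩ := htp
  -- `2•η = −(N_e•t_e + N_p•t_p)`
  have h2D := two_zsmul_cosetSum_sub_quarterSum (K := K) (rq := rq) hrp hrp0 (Affine.Point.some x₁ y₁ hxy)
  rw [← hD] at h2D
  have h2η : (2 : ℤ) • (N • D + (2 * Ne) • Re + (2 * Np) • Rp) = -(Ne • te + Np • tp) := by
    have hN1 : ∀ X : (cm7.baseChange L).toAffine.Point, N • X = Ne • (Me • X) := fun X ↦ by rw [smul_smul, ← hNe]
    have hN2 : ∀ X : (cm7.baseChange L).toAffine.Point, N • X = Np • (Mp • X) := fun X ↦ by rw [smul_smul, ← hNp]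
    have e1 : (2 : ℤ) • (N • D) = -(Ne • (Me • ∑ σ : L ≃ₐ[K] L,
        ((if σ rq = rq then (1 : ℤ) else -1) * (if σ rp = rp then (1 : ℤ) else -1)) •
          Affine.Point.map (σ : L →ₐ[K] L) (Affine.Point.some x₁ y₁ hxy)) +
        Np • (Mp • ∑ σ : L ≃ₐ[K] L, (if σ rp = rp then (1 : ℤ) else -1) •
          Affine.Point.map (σ : L →ₐ[K] L) (Affine.Point.some x₁ y₁ hxy))) := by
      rw [smul_comm (2 : ℤ) N D, h2D, zsmul_neg, zsmul_add, hN1, hN2]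
    rw [zsmul_add, zsmul_add, e1, hPe, hPp]
    simp only [zsmul_add, smul_smul]
    rw [show (2 : ℤ) * (2 * Ne) = Ne * 4 by ring, show (2 : ℤ) * (2 * Np) = Np * 4 by ring]
    abel
  -- the odd multiple `k = ke * kp`: `2•(kη) ∈ {O,T}`, hence `4•(kη) = 0`, hence `kη ∈ {O,T}`
  set k : ℤ := ke * kp with hk
  have hkodd : Odd k := hke.mul hkp
  have h2k : (2 : ℤ) • (k • (N • D + (2 * Ne) • Re + (2 * Np) • Rp)) = 0 ∨
      (2 : ℤ) • (k • (N • D + (2 * Ne) • Re + (2 * Np) • Rp)) = T := by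
    rw [smul_comm, h2η, zsmul_neg, zsmul_add, smul_smul, smul_smul, show k * Ne = (kp * Ne) * ke by rw [hk]; ring,
      show k * Np = (ke * Np) * kp by rw [hk]; ring]
    have h1 := zsmul_mem_pair_of_zsmul_mem_pair hT2 hkeu (kp * Ne)
    have h2 := zsmul_mem_pair_of_zsmul_mem_pair hT2 hkpu (ke * Np)
    have h3 := add_mem_zero_or_twoTorsion hT2 h1 h2
    rcases h3 with h | h
    · left; rw [h, neg_zero]
    · right; rw [h]; exact neg_eq_iff_add_eq_zero.mpr (by rw [← two_nsmul]; exact hT2)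
  have h4k : (4 : ℤ) • (k • (N • D + (2 * Ne) • Re + (2 * Np) • Rp)) = 0 := by
    rw [show (4 : ℤ) = 2 * 2 by norm_num, mul_zsmul]
    rcases h2k with h | h
    · rw [h, zsmul_zero]
    · rw [h, hT2z]
  refine ⟨k, hkodd, ?_⟩
  rcases h4 _ h4k with h0 | hT'
  · exact h0
  · exfalso
    -- `kη = T` ⇒ `(kN)•D = 2•(−k(N_eR_e + N_pR_p)) + T` ⇒ §4 ⇒ a forbidden square
    have hrel : (k * N) • D = (2 : ℤ) • (-(k • (Ne • Re + Np • Rp))) + T := by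
      have e := hT'
      rw [zsmul_add, zsmul_add, smul_smul, smul_smul, smul_smul] at e
      linear_combination (norm := module) e
    exact hX2 _ (isSquare_seven_mul_prod_of_odd_zsmul_cosetDifference (K := K) hrp hrp0 hxy hx2 (hkodd.mul hN) _ hrel)

end Key

end Summit.BirchSwinnertonDyer.BirchSwinnertonDyer.Theorems.GoldfeldGoodTwists

end
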